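import Summits.BirchSwinnertonDyer.BirchSwinnertonDyer.Theorems.ThetaPartnerAtTwoSignedTransportAtTwoLocalTransport
import Summits.BirchSwinnertonDyer.Rank1Residual.Additive.LocalModelTransportTower
import Mathlib.NumberTheory.Padics.HeightOneSpectrum
import HarnessLib

/-!
# `stub_sel2Tb` of line `bridge` (crux `SignedTransportAtTwo`, stmt-BirchSwinnertonDyer-20333, route `ThetaPartnerAtTwo`): the
# local transport at `2` — a `Gal(ℚ̄₂/ℚ₂)`-equivariant homomorphism `W(ℚ̄₂) → A(ℚ̄₂)` restricting to the given `W[2] ≃ A[2]`,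
# in the currency of the adic model `ℚ_v`, `v ∣ 2` (lead prover bsd-wall-tp2-p1 g5; `--supports stmt-BirchSwinnertonDyer-20333`,
# REGISTERED STUB; route-independent, closes nothing by itself)

HONEST FRAMING. THEOREMS ONLY (no definition); nothing about any Selmer group is asserted; BSD is not proved by any of this.
No import of any route file.

WHAT. §1 transports `exists_equivariant_hom_padic` (Mathlib's `ℚ_[2]`) to any `ℚ_[2]`-algebra `E` algebraic over `ℚ_[2]` (the
tree's `LocalModelTransport*`: `E(K̄_{ℚ_2}) ≃ E(K̄_E)` along the chosen `ℚ̄₂ → Ē`, equivariant for `Γ_E → Γ_{ℚ₂}`, and the two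
embeddings `ℚ̄ → Ē` differ by some `τ ∈ Γ_ℚ`); §2 takes `E = ℚ_v` with Mathlib's `padicEquiv : ℚ_v ≃ ℚ_[2]`; §3 is the registered
stub `stub_sel2Tb` VERBATIM (Kim 2009 Prop. 2.11–2.12 / Kobayashi §8 READ AT `2`: `Ê(𝔪̄) ≅ Ê'(𝔪̄)` for the Honda type `X² + 2`,
killed odd torsion, residual rigidity from the `S₃`-image at `2`).

References: [Kobayashi2003] §8.4; [BDKim2009] Prop. 2.11–2.12 (p. 186); [Serre1972] §5.3; [SilvermanAEC2009] VII.2, VIII.§1.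
-/

set_option autoImplicit false
-- D-0017: single-problem summit, so `Summit.BirchSwinnertonDyer.BirchSwinnertonDyer.…` repeats a namespace BY DESIGN.
set_option linter.dupNamespace false

noncomputable section

open scoped Classical NNReal AddSubgroup

open WeierstrassCurve Literature.NumberTheory.EllipticCurves Literature.NumberTheory.GaloisRepresentations
  Literature.NumberTheory.EllipticCurves.Rank1Residual NumberField IsDedekindDomain
  Summit.BirchSwinnertonDyer.Rank1Residual.Additive Field

namespace Summit.BirchSwinnertonDyer.BirchSwinnertonDyer.Theorems.SignedTransportAtTwo

/-! ## §1 Change of the model of `ℚ₂` -/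

section Model

variable (W A : WeierstrassCurve ℚ) [W.IsElliptic] [W.IsGloballyMinimal] [A.IsElliptic] [A.IsGloballyMinimal]
  (E : Type) [Field E] [Algebra ℚ E] [Algebra ℚ_[2] E] [IsScalarTower ℚ ℚ_[2] E] [Algebra.IsAlgebraic ℚ_[2] E]

/-- **The local transport at `2`, for any model `E ⊇ ℚ_[2]` algebraic over `ℚ_[2]`** (e.g. `E ≅ ℚ_[2]`): a
`Γ_E`-equivariant additive `Ψ : W(K̄_E) → A(K̄_E)` restricting to `ẽ` along the chosen embedding `ℚ̄ → K̄_E` — transported from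
`exists_equivariant_hom_padic` along `E(K̄_{ℚ₂}) ≃ E(K̄_E)`. [cite: BDKim2009, Prop. 2.11–2.12 (p. 186)] [cite: SerreGaloisCohomology1997, II §1.1] -/
theorem exists_equivariant_hom_of_algebra (hssW : GoodSS W 2) (ha2W : W.frobeniusTrace 2 = 0) (hssA : GoodSS A 2)
    (ha2A : A.frobeniusTrace 2 = 0) (e' : ↥((↥(W.geomPrimaryTorsion 2))[(2 : ℤ)]) ≃+ ↥((↥(A.geomPrimaryTorsion 2))[(2 : ℤ)]))
    (he' : ∀ (σ : absoluteGaloisGroup ℚ) (x : ↥((↥(W.geomPrimaryTorsion 2))[(2 : ℤ)])), e' (σ • x) = σ • e' x) :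
    ∃ Ψ : localPoints W E →+ localPoints A E,
      (∀ (τ : absoluteGaloisGroup E) (P : localPoints W E), Ψ (τ • P) = τ • Ψ P) ∧
      (∀ x : ↥((↥(W.geomPrimaryTorsion 2))[(2 : ℤ)]),
        Ψ (pointsMapOfEmb W (closureEmb (K := ℚ) E) ((x : W.geomPrimaryTorsion 2) : W.geomPoints)) =
          pointsMapOfEmb A (closureEmb (K := ℚ) E) ((e' x : A.geomPrimaryTorsion 2) : A.geomPoints)) := by
  -- the transport over `ℚ_[2]`, along the chosen `ℚ̄ → ℚ̄₂`
  obtain ⟨Ψ₂, hΨ₂σ, hΨ₂e⟩ :=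
    exists_equivariant_hom_padic W A hssW ha2W hssA ha2A (closureEmb (K := ℚ) ℚ_[2]) e' he'
  -- comparison of the two embeddings `ℚ̄ → Ē`
  obtain ⟨τ, hτ⟩ := LocalModelTransport.exists_smul_absClosureEmbedding_eq ℚ ℚ_[2] E
  -- `E(K̄_{ℚ₂}) ≃ E(K̄_E)` along `j : ℚ̄₂ → Ē`
  set jW : localPoints W ℚ_[2] →+ localPoints W E :=
    Affine.Point.map (W' := W) ((absClosureEmbedding ℚ_[2] E).restrictScalars ℚ) with hjW
  set jA : localPoints A ℚ_[2] →+ localPoints A E :=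
    Affine.Point.map (W' := A) ((absClosureEmbedding ℚ_[2] E).restrictScalars ℚ) with hjA
  have hjWbij : Function.Bijective jW :=
    ⟨Affine.Point.map_injective (W' := W) _, fun R ↦ LocalModelTransport.exists_map_eq_localPoints W ℚ_[2] E R⟩
  set eW := AddEquiv.ofBijective jW hjWbij with heW
  have heWapp : ∀ Q, eW Q = jW Q := fun Q ↦ rfl
  let Ψ : localPoints W E →+ localPoints A E := jA.comp (Ψ₂.comp eW.symm.toAddMonoidHom)
  have hΨ : ∀ Q, Ψ (jW Q) = jA (Ψ₂ Q) := fun Q ↦ by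
    change jA (Ψ₂ (eW.symm (jW Q))) = _
    rw [← heWapp, AddEquiv.symm_apply_apply]
  -- `j (r σ • Q) = σ • j Q`
  have hjWσ : ∀ (σ : absoluteGaloisGroup E) (Q : localPoints W ℚ_[2]), jW (absGaloisRestrict ℚ_[2] E σ • Q) = σ • jW Q :=
    fun σ Q ↦ LocalModelTransport.map_smul_localPoints W ℚ_[2] E σ Q
  have hjAσ : ∀ (σ : absoluteGaloisGroup E) (Q : localPoints A ℚ_[2]), jA (absGaloisRestrict ℚ_[2] E σ • Q) = σ • jA Q :=
    fun σ Q ↦ LocalModelTransport.map_smul_localPoints A ℚ_[2] E σ Q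
  refine ⟨Ψ, fun σ P ↦ ?_, fun x ↦ ?_⟩
  · obtain ⟨Q, rfl⟩ := hjWbij.2 P
    rw [← hjWσ, hΨ, hΨ, hΨ₂σ, hjAσ]
  · -- `ι_E y = j (ι₂ (τ⁻¹ • y))`
    have hWy : ∀ y : W.geomPoints, pointsMapOfEmb W (closureEmb (K := ℚ) E) y =
        jW (pointsMapOfEmb W (closureEmb (K := ℚ) ℚ_[2]) (τ⁻¹ • y)) := fun y ↦ by
      have h := LocalModelTransport.pointsMap_smul_eq_map_pointsMap W ℚ_[2] E hτ (τ⁻¹ • y)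
      rw [smul_inv_smul] at h
      exact h
    have hAy : ∀ y : A.geomPoints, pointsMapOfEmb A (closureEmb (K := ℚ) E) y =
        jA (pointsMapOfEmb A (closureEmb (K := ℚ) ℚ_[2]) (τ⁻¹ • y)) := fun y ↦ by
      have h := LocalModelTransport.pointsMap_smul_eq_map_pointsMap A ℚ_[2] E hτ (τ⁻¹ • y)
      rw [smul_inv_smul] at h
      exact h
    rw [hWy, hAy, hΨ]
    congr 1
    have h1 : τ⁻¹ • ((x : W.geomPrimaryTorsion 2) : W.geomPoints) =
        (((τ⁻¹ • x : ↥((↥(W.geomPrimaryTorsion 2))[(2 : ℤ)])) : W.geomPrimaryTorsion 2) : W.geomPoints) := rfl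
    have h2 : τ⁻¹ • ((e' x : A.geomPrimaryTorsion 2) : A.geomPoints) =
        (((τ⁻¹ • e' x : ↥((↥(A.geomPrimaryTorsion 2))[(2 : ℤ)])) : A.geomPrimaryTorsion 2) : A.geomPoints) := rfl
    rw [h1, h2, hΨ₂e, he']

end Model

/-! ## §2 The adic model `ℚ_v`, `v ∣ 2` -/

section Place

open Rat.HeightOneSpectrum

/-- A finite place `v` of `ℚ` containing the rational prime `p` is the place of `p` (`primesEquiv v = p`). [folklore] -/
theorem coe_primesEquiv_eq_of_natCast_mem' {p : ℕ} [hp : Fact p.Prime] {v : HeightOneSpectrum (𝓞 ℚ)}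
    (hpv : (p : 𝓞 ℚ) ∈ v.asIdeal) : ((primesEquiv v : Nat.Primes) : ℕ) = p := by
  have h : natGenerator v ∣ p := by
    rw [natGenerator_dvd_iff, ← map_natCast (Rat.IsIntegralClosure.intEquiv (𝓞 ℚ)) p]
    exact Ideal.mem_map_of_mem _ hpv
  exact (Nat.prime_dvd_prime_iff_eq (prime_natGenerator v) hp.out).mp h

/-- **`ℚ_[p] ≃ ℚ_v`** as `ℚ`-algebras at the place `v ∋ p` of `ℚ` (Mathlib's `adicCompletion.padicEquiv`). [folklore] -/
theorem nonempty_algEquiv_padic_adicCompletion {p : ℕ} [Fact p.Prime] {v : HeightOneSpectrum (𝓞 ℚ)}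
    (hpv : (p : 𝓞 ℚ) ∈ v.asIdeal) : Nonempty (ℚ_[p] ≃ₐ[ℚ] v.adicCompletion ℚ) := by
  obtain rfl : ((primesEquiv v : Nat.Primes) : ℕ) = p := coe_primesEquiv_eq_of_natCast_mem' hpv
  exact ⟨(adicCompletion.padicEquiv v).toAlgEquiv.symm⟩

end Place

/-! ## §3 The registered stub -/

/-- **stub sel2Tb** (the HEART of line `bridge`, in the currency of LOCAL POINTS; Kim 2009 Prop. 2.11–2.12 / Kobayashi §8 READ AT `2`):
on the theta habitat, at the place above `2`, there is a `Gal(ℚ̄₂/ℚ₂)`-equivariant homomorphism `Ψ : W(ℚ̄₂) → A(ℚ̄₂)`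
restricting, on the residual module `W[2^∞][2]` (through the chosen embeddings), to the given equivariant `ẽ`. PROOF: the Honda
series `ψ ∈ Xℤ₂⟦X⟧` with `log_A ∘ ψ = log_W` (p544432; both of Honda type `X² + 2`) is a formal-group homomorphism, evaluated on
`Ŵ(𝔪̄) ⊂ W(ℚ̄₂)` through complete subfields, precomposed with the equivariant projection along the odd torsion
(`W(ℚ̄₂) = Ŵ(𝔪̄) ⊕ W(ℚ̄₂)[odd]`, `W̃` supersingular); it agrees with `ẽ` on `W[2]` because the image of `Gal(ℚ̄₂/ℚ₂)` in
`Aut W[2] ≅ S₃` is `S₃` (`Δ_min ≡ 5 mod 8`, no `ℚ₂`-rational point of order `2`). The hypotheses `¬ W.HasCM`,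
`W.analyticRank = 0`, `A.HasCM`, the global `W[2] ≃ A[2]` and `κ` are not used. [cite: BDKim2009, Prop. 2.11–2.12 (p. 186)]
[cite: Kobayashi2003, §8.4] [cite: Serre1972, §5.3] -/
theorem stub_sel2Tb :
    ∀ (W : WeierstrassCurve ℚ) [W.IsElliptic] [W.IsGloballyMinimal] (A : WeierstrassCurve ℚ) [A.IsElliptic]
      [A.IsGloballyMinimal], ¬ W.HasCM → W.analyticRank = 0 → GoodSS W 2 → W.frobeniusTrace 2 = 0 →
      A.HasCM → GoodSS A 2 → A.frobeniusTrace 2 = 0 →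
    (∃ e : WeierstrassCurve.geomTorsion W (2 : ℤ) ≃+ WeierstrassCurve.geomTorsion A (2 : ℤ),
      ∀ (σ : Field.absoluteGaloisGroup ℚ) (P : WeierstrassCurve.geomTorsion W (2 : ℤ)), e (σ • P) = σ • e P) →
    ∀ (κ : ZpExtension ℚ 2), κ.IsCyclotomic →
    ∀ (e' : ↥((↥(W.geomPrimaryTorsion 2))[(2 : ℤ)]) ≃+ ↥((↥(A.geomPrimaryTorsion 2))[(2 : ℤ)]))
      (he' : ∀ (σ : Field.absoluteGaloisGroup ℚ) (x : ↥((↥(W.geomPrimaryTorsion 2))[(2 : ℤ)])), e' (σ • x) = σ • e' x),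
    ∀ (v : HeightOneSpectrum (𝓞 ℚ)), ((2 : ℕ) : 𝓞 ℚ) ∈ v.asIdeal →
    ∃ Ψ : localPoints W (v.adicCompletion ℚ) →+ localPoints A (v.adicCompletion ℚ),
      (∀ (τ : Field.absoluteGaloisGroup (v.adicCompletion ℚ)) (P : localPoints W (v.adicCompletion ℚ)),
          Ψ (τ • P) = τ • Ψ P) ∧
      (∀ x : ↥((↥(W.geomPrimaryTorsion 2))[(2 : ℤ)]),
        Ψ (pointsMapOfEmb W (closureEmb (K := ℚ) (v.adicCompletion ℚ)) ((x : W.geomPrimaryTorsion 2) : W.geomPoints)) =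
          pointsMapOfEmb A (closureEmb (K := ℚ) (v.adicCompletion ℚ)) ((e' x : A.geomPrimaryTorsion 2) : A.geomPoints)) := by
  intro W _ _ A _ _ _ _ hssW ha2W _ hssA ha2A _ κ _ e' he' v hv
  obtain ⟨e⟩ := nonempty_algEquiv_padic_adicCompletion (p := 2) (v := v) (by exact_mod_cast hv)
  letI : Algebra ℚ_[2] (v.adicCompletion ℚ) := (e : ℚ_[2] →ₐ[ℚ] v.adicCompletion ℚ).toRingHom.toAlgebra
  haveI : IsScalarTower ℚ ℚ_[2] (v.adicCompletion ℚ) :=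
    IsScalarTower.of_algebraMap_eq fun r ↦ ((e : ℚ_[2] →ₐ[ℚ] v.adicCompletion ℚ).commutes r).symm
  haveI : Algebra.IsAlgebraic ℚ_[2] (v.adicCompletion ℚ) := ⟨fun x ↦ by
    have hx : x = algebraMap ℚ_[2] (v.adicCompletion ℚ) (e.symm x) := (e.apply_symm_apply x).symm
    rw [hx]
    exact isAlgebraic_algebraMap _⟩
  exact exists_equivariant_hom_of_algebra W A (v.adicCompletion ℚ) hssW ha2W hssA ha2A e' he'

end Summit.BirchSwinnertonDyer.BirchSwinnertonDyer.Theorems.SignedTransportAtTwo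

end
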